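import Summits.ResolutionOfSingularities.ResolutionOfSingularities.Theorems.InertDescentLU4
import Summits.ResolutionOfSingularities.ResolutionOfSingularities.Theorems.DecompositionDescentLU5
import Summits.ResolutionOfSingularities.ResolutionOfSingularities.Theorems.TameAbelianQuotientLU4
import HarnessLib

/-!
# InertDescentLU (5/5) — the located residual R28; the cuts `R25 ↔ R28`, `R27 ↔ R28`, `R26 ↔ R28`; ROOT BY NAME; the
cell is exactly `RelLU`

Part 5 of the g28 node `InertDescentLU` of the ROOT/RESIDUAL decomposition cell `decomp-res` (lens 1, window
(W-inert) of critic row 207); see the module docstring of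
`Summits.ResolutionOfSingularities.ResolutionOfSingularities.Theorems.InertDescentLU` (part 1/5) for the thesis, the engine
(faithfully flat descent of regularity [Matsumura 23.7 (i)] + standard-étale over normal is normal [Stacks 03GD]),
the law `UnramifiedWitnessLUAbove k O → RelLocalUniformization k K O`, the residual R28, the cuts and the sources.
Problem side, sorry-free, hypothesis-free.

This part (imports g27's slice `DecompositionDescentLU5` and g26's `TameAbelianQuotientLU4`): the decided cell piece
`NonKHToricArchLUKeyHenselDescentQuotInertCell` (`_holds`), the located residual R28 `NonKHToricArchLUKeyHenselDescentQuotInert`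
(docstring = the honest located residual), the exact cuts `…Quot_iff_inert : R25 ↔ R28`, `…QuotDec_iff_inert : R27 ↔ R28`,
`…Abel_iff_inert : R26 ↔ R28`, `nonKHToricArchLUKeyHenselDescent_iff_inert : R23 ↔ R28`, `nonKHToricArchLU_iff_inert`,
`…Inert_of_root`, `closes_inert` (the summit by name, binders printed), `root_iff_inert_sigma`, and — said openly —
`unramifiedWitnessLUAbove_iff_relLU` with `not_unramifiedWitnessLUAbove_iff_not_relLU`.
-/

noncomputable section

open IsLocalRing Polynomial Literature.AlgebraicGeometry.Resolution

namespace Summit.ResolutionOfSingularities.ResolutionOfSingularities.Theorems.InertDescentLU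

universe u

variable {E : Type u} [Field E] (OE : ValuationSubring E)

/-! ## PART E — the located residual re-cut OFF THE RESIDUE-FREE WITNESS CELL: decided piece, `R25 ↔ R28`
(exact, hypothesis-free), ROOT BY NAME -/

section Cut

variable {k K : Type} [Field k] [Field K] [Algebra k K]

open Summit.ResolutionOfSingularities.ResolutionOfSingularities.Theses
open Summit.ResolutionOfSingularities.ResolutionOfSingularities.Theorems
open Summit.ResolutionOfSingularities.ResolutionOfSingularities.Theorems.KeyChainLU
open Summit.ResolutionOfSingularities.ResolutionOfSingularities.Theorems.HenselKeyChainLU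
open Summit.ResolutionOfSingularities.ResolutionOfSingularities.Theorems.GaloisDescentLU
open Summit.ResolutionOfSingularities.ResolutionOfSingularities.Theorems.PfaffLine
open Summit.ResolutionOfSingularities.ResolutionOfSingularities.Theorems.ToricLadder
open Summit.ResolutionOfSingularities.ResolutionOfSingularities.Theorems.KaplanskyLadder
open Summit.ResolutionOfSingularities.ResolutionOfSingularities.Theorems.PerronLadder
open Summit.ResolutionOfSingularities.ResolutionOfSingularities.Theorems.DefectlessLadder
open Summit.ResolutionOfSingularities.ResolutionOfSingularities.Theorems.WCut
open Summit.ResolutionOfSingularities.ResolutionOfSingularities.Theorems.TameQuotientLU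
open Summit.ResolutionOfSingularities.ResolutionOfSingularities.Theorems.DecompositionDescentLU

/-- **DECIDED PIECE** (tag DECIDED — a kernel THEOREM, `nonKHToricArchLUKeyHenselDescentQuotInertCell_holds`;
WEAKER than the root; located at `(e, c, n) = (3, 3, 4)`): the located residual of g25 restricted to the
RESIDUE-FREE WITNESS CELL `UnramifiedWitnessLUAbove` (inert layers allowed). -/
def NonKHToricArchLUKeyHenselDescentQuotInertCell (e c n : ℕ) : Prop :=
  ∀ p : ℕ, p.Prime → ∀ (k K : Type) [Field k] [CharP k p] [Field K] [Algebra k K],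
    Algebra.trdeg k K ≤ n → ∀ O : ValuationSubring K, Nonempty O.valuation.RankOne →
    (∀ y ∈ O, ∃ f : Polynomial k, f ≠ 0 ∧ Polynomial.aeval y f ∈ O.nonunits) →
    ¬ IsAbhyankarPlace O (algebraMap k K).fieldRange ⊤ →
    ¬ (∃ d : ℕ, d < n ∧ SepDenseBelow k O d) → ¬ ToricDenseBelow k O e → ¬ KHTopBelow k O c →
    ¬ KeyChainTopBelow k O → ¬ HenselKeyChainTopBelow k O → ¬ GaloisHenselDescentDatum k O →
    ¬ TameQuotientLU.TameEquivariantLUAbove k O →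
    UnramifiedWitnessLUAbove k O → RelLocalUniformization k K O

/-- THE LAW DECIDES THE CELL PIECE outright, for all parameters (no port, no fact binder). [folklore] -/
theorem nonKHToricArchLUKeyHenselDescentQuotInertCell_holds (e c n : ℕ) :
    NonKHToricArchLUKeyHenselDescentQuotInertCell e c n :=
  fun _ _ _ _ _ _ _ _ _ _ _ _ _ _ _ _ _ _ _ _ hU => relLU_of_unramifiedWitnessLUAbove hU

/-- **NEW LOCATED RESIDUAL `R28`** (tag UNDECIDED · WEAKER than the root · located at `(e, c, n) = (3, 3, 4)`):
the located residual OFF the key-chain, Hensel, descent, tame-quotient, BOTH decomposition-descent cells AND THE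
RESIDUE-FREE WITNESS CELL — for NO finite separable top `K′ ⊆ K̄` do the models of `K` carry standard-étale
witnesses `x′ ⊆ K′ ∩ O_E` (monic over the model, unit derivative at the centre; NO residue condition) making
them regular upstairs.  HONEST LOCATED RESIDUAL (row 207 (i7)): with (W-inert) the STANDARD-ÉTALE-WITNESS AXIS
is consumed WHOLE (every top étale at the centre of `O_E`: split, `K`-rational-residue = henselization layers,
inert = strict-henselization layers with ANY separable residue extension); what remains below `K^{sep}` for this
programme is (α) TAME RAMIFICATION with residues NOT in `k` (the g25/g26 tame cells require `κ = k`; NOT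
consumed here and NOT claimed: composing them with this law along `K ⊂ K^{sh} ⊂ K^{tr}` is not typed — row
207's door (W-α) WHOLE), (β) WILD ramification ((W-wild) mod Theorem D), (γ) the defect / immediate world ((K-D),
(K-c)); purely inseparable residue extensions and rank/defect phenomena are untouched.  UNMATCHED CLAUSES
(exhaustiveness bookkeeping, 0-weight): the exhaustiveness iff `Unramified ↔ DecWitness ∨ inert-datum` is NOT
typed (no `κ(O)`-perfectness assumed anywhere in this node). -/
def NonKHToricArchLUKeyHenselDescentQuotInert (e c n : ℕ) : Prop :=
  ∀ p : ℕ, p.Prime → ∀ (k K : Type) [Field k] [CharP k p] [Field K] [Algebra k K],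
    Algebra.trdeg k K ≤ n → ∀ O : ValuationSubring K, Nonempty O.valuation.RankOne →
    (∀ y ∈ O, ∃ f : Polynomial k, f ≠ 0 ∧ Polynomial.aeval y f ∈ O.nonunits) →
    ¬ IsAbhyankarPlace O (algebraMap k K).fieldRange ⊤ →
    ¬ (∃ d : ℕ, d < n ∧ SepDenseBelow k O d) → ¬ ToricDenseBelow k O e → ¬ KHTopBelow k O c →
    ¬ KeyChainTopBelow k O → ¬ HenselKeyChainTopBelow k O → ¬ GaloisHenselDescentDatum k O →
    ¬ TameQuotientLU.TameEquivariantLUAbove k O →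
    ¬ DecompositionFieldLUAbove k O → ¬ DecWitnessLUAbove k O → ¬ UnramifiedWitnessLUAbove k O →
    RelLocalUniformization k K O

/-- Dropping the three negated cell hypotheses: `R25 → R28`. [folklore] -/
theorem nonKHToricArchLUKeyHenselDescentQuotInert_of_quot {e c n : ℕ}
    (h : NonKHToricArchLUKeyHenselDescentQuot e c n) : NonKHToricArchLUKeyHenselDescentQuotInert e c n :=
  fun p hp k K _ _ _ _ hd O h1 h0 hA hnd hnt hnk hkey hH hG hT _ _ _ =>
    h p hp k K hd O h1 h0 hA hnd hnt hnk hkey hH hG hT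

/-- **THE INERT-DESCENT CUT FROM `R25`** (kernel, exact, hypothesis-free): the g25 located residual is EQUIVALENT
to its part off the decomposition cells and the residue-free witness cell — on the cells the laws decide
(`relLU_of_decompositionFieldLUAbove`, g27; `relLU_of_unramifiedWitnessLUAbove` here, which also covers
`DecWitnessLUAbove` by `decWitness_le_unramifiedWitness`). [folklore] -/
theorem nonKHToricArchLUKeyHenselDescentQuot_iff_inert {e c n : ℕ} :
    NonKHToricArchLUKeyHenselDescentQuot e c n ↔ NonKHToricArchLUKeyHenselDescentQuotInert e c n := by
  refine ⟨nonKHToricArchLUKeyHenselDescentQuotInert_of_quot,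
    fun h p hp k K _ _ _ _ hd O hr hz hA hnd hnt hnk hkey hH hG hT => ?_⟩
  by_cases hU : UnramifiedWitnessLUAbove k O
  · exact relLU_of_unramifiedWitnessLUAbove hU
  by_cases hD : DecompositionFieldLUAbove k O
  · exact relLU_of_decompositionFieldLUAbove hD
  exact h p hp k K hd O hr hz hA hnd hnt hnk hkey hH hG hT hD
    (not_decWitnessLUAbove_of_not_unramifiedWitnessLUAbove hU) hU

/-- The EXACT re-location at the programme's parameters `(3, 3, 4)` (`R25 ↔ R28`, hypothesis-free). [folklore] -/
theorem nonKHToricArchLUKeyHenselDescentQuot334_iff_inert :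
    NonKHToricArchLUKeyHenselDescentQuot 3 3 4 ↔ NonKHToricArchLUKeyHenselDescentQuotInert 3 3 4 :=
  nonKHToricArchLUKeyHenselDescentQuot_iff_inert

/-- The g23 located residual re-located in one step (`R23 ↔ R28`). [folklore] -/
theorem nonKHToricArchLUKeyHenselDescent_iff_inert {e c n : ℕ} :
    NonKHToricArchLUKeyHenselDescent e c n ↔ NonKHToricArchLUKeyHenselDescentQuotInert e c n :=
  nonKHToricArchLUKeyHenselDescent_iff_quot.trans nonKHToricArchLUKeyHenselDescentQuot_iff_inert

/-- The TRUE residual family of g17/g20 (`NonKHToricArchLU`) re-located: off the key-chain, Hensel, descent,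
tame-quotient, decomposition-descent and residue-free witness cells. [folklore] -/
theorem nonKHToricArchLU_iff_inert {e c n : ℕ} :
    NonKHToricArchLU e c n ↔ NonKHToricArchLUKeyHenselDescentQuotInert e c n :=
  nonKHToricArchLU_iff_quot.trans nonKHToricArchLUKeyHenselDescentQuot_iff_inert

/-- The new residual follows from the root outright (it is a WEAKER piece). [folklore] -/
theorem nonKHToricArchLUKeyHenselDescentQuotInert_of_root (hS : _root_.ResolutionOfSingularities)
    (e c n : ℕ) : NonKHToricArchLUKeyHenselDescentQuotInert e c n :=
  nonKHToricArchLUKeyHenselDescentQuotInert_of_quot (nonKHToricArchLUKeyHenselDescentQuot_of_root hS e c n)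

/-- **`closes_inert` — ROOT BY NAME (deciding theorem of this node; binders PRINTED, row 207 (i4)):**
`(hCP : CossartPiltant2019LU3)` the Cossart–Piltant dimension-3 floor (print) · `(hCJS :
CossartJannsenSaito2020Embedded)` embedded resolution of excellent surfaces (named fact) · `(hAsc : KK05NCVAscent)`
the Knaf–Kuhlmann (NC)+(V) ascent Π₁ (print, MAP +1 pending) · `(hN : ∀ d ≥ 4, R28 3 3 d)` the located residual
OFF the key-chain, Hensel, descent, tame-quotient, decomposition-descent AND residue-free witness cells ·
`(h₃ : Valuative.PatchingRel)` the patching crux 0642 of route Valuative ⇒ `ResolutionOfSingularities`.  All six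
cells are discharged INSIDE the kernel. [folklore] -/
theorem closes_inert (hCP : CossartPiltant2019LU3.{0}) (hCJS : CossartJannsenSaito2020Embedded.{0})
    (hAsc : KK05NCVAscent) (hN : ∀ d, 4 ≤ d → NonKHToricArchLUKeyHenselDescentQuotInert 3 3 d)
    (h₃ : Valuative.PatchingRel) : _root_.ResolutionOfSingularities :=
  closes_quot hCP hCJS hAsc (fun d hd => nonKHToricArchLUKeyHenselDescentQuot_iff_inert.2 (hN d hd)) h₃

/-- Root-level summary: modulo floor + CJS + Π₁ + 0642 the ROOT is EQUIVALENT to the residual family off the six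
cells. [folklore] -/
theorem root_iff_inert_sigma (hCP : CossartPiltant2019LU3.{0})
    (hCJS : CossartJannsenSaito2020Embedded.{0}) (hAsc : KK05NCVAscent) (h₃ : Valuative.PatchingRel) :
    _root_.ResolutionOfSingularities ↔ ∀ d, 4 ≤ d → NonKHToricArchLUKeyHenselDescentQuotInert 3 3 d := by
  rw [root_iff_quot_sigma hCP hCJS hAsc h₃]
  exact forall₂_congr fun d _ => nonKHToricArchLUKeyHenselDescentQuot_iff_inert

end Cut

/-! ## PART F — the cuts from g27's and g26's residuals: `R27 ↔ R28`, `R26 ↔ R28` (exact, hypothesis-free);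
`RelLU` places lie in the residue-free cell (said openly) -/

section Cut6

variable {k K : Type} [Field k] [Field K] [Algebra k K]

open Summit.ResolutionOfSingularities.ResolutionOfSingularities.Theses
open Summit.ResolutionOfSingularities.ResolutionOfSingularities.Theorems
open Summit.ResolutionOfSingularities.ResolutionOfSingularities.Theorems.TameQuotientLU
open Summit.ResolutionOfSingularities.ResolutionOfSingularities.Theorems.DecompositionDescentLU
open Summit.ResolutionOfSingularities.ResolutionOfSingularities.Theorems.TameAbelianQuotientLU

/-- Dropping the negated residue-free hypothesis: `R27 → R28`. [folklore] -/
theorem nonKHToricArchLUKeyHenselDescentQuotInert_of_dec {e c n : ℕ}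
    (h : NonKHToricArchLUKeyHenselDescentQuotDec e c n) : NonKHToricArchLUKeyHenselDescentQuotInert e c n :=
  fun p hp k K _ _ _ _ hd O h1 h0 hA hnd hnt hnk hkey hH hG hT hD hW _ =>
    h p hp k K hd O h1 h0 hA hnd hnt hnk hkey hH hG hT hD hW

/-- **THE INERT-DESCENT CUT `R27 ↔ R28`** (kernel, exact, hypothesis-free; row 207 (i4)): g27's located
residual is EQUIVALENT to its part off the residue-free witness cell — on the cell the law
`relLU_of_unramifiedWitnessLUAbove` decides. [folklore] -/
theorem nonKHToricArchLUKeyHenselDescentQuotDec_iff_inert {e c n : ℕ} :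
    NonKHToricArchLUKeyHenselDescentQuotDec e c n ↔ NonKHToricArchLUKeyHenselDescentQuotInert e c n := by
  refine ⟨nonKHToricArchLUKeyHenselDescentQuotInert_of_dec,
    fun h p hp k K _ _ _ _ hd O hr hz hA hnd hnt hnk hkey hH hG hT hD hW => ?_⟩
  by_cases hU : UnramifiedWitnessLUAbove k O
  · exact relLU_of_unramifiedWitnessLUAbove hU
  · exact h p hp k K hd O hr hz hA hnd hnt hnk hkey hH hG hT hD hW hU

/-- The EXACT re-location at the programme's parameters `(3, 3, 4)` (`R27 ↔ R28`). [folklore] -/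
theorem nonKHToricArchLUKeyHenselDescentQuotDec334_iff_inert :
    NonKHToricArchLUKeyHenselDescentQuotDec 3 3 4 ↔ NonKHToricArchLUKeyHenselDescentQuotInert 3 3 4 :=
  nonKHToricArchLUKeyHenselDescentQuotDec_iff_inert

/-- The owed anchoring of g26's tame-abelian residual, one step further: `R26 ↔ R28` (through the tree's
`TameAbelianQuotientLU.nonKHToricArchLUKeyHenselDescentQuot_iff_abel : R25 ↔ R26`). [folklore] -/
theorem nonKHToricArchLUKeyHenselDescentAbel_iff_inert {e c n : ℕ} :
    NonKHToricArchLUKeyHenselDescentAbel e c n ↔ NonKHToricArchLUKeyHenselDescentQuotInert e c n :=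
  nonKHToricArchLUKeyHenselDescentQuot_iff_abel.symm.trans nonKHToricArchLUKeyHenselDescentQuot_iff_inert

/-- **Said openly: every place uniformizable below lies in the residue-free witness cell** (`K′ = K`, `x′ = ∅`;
g27's `decWitnessLUAbove_of_relLU` and `decWitness_le_unramifiedWitness`), so the cell is EQUIVALENT to
`RelLocalUniformization k K O`; the content of the law is the genuine inert tops. [folklore] -/
theorem unramifiedWitnessLUAbove_of_relLU {O : ValuationSubring K} (h : RelLocalUniformization k K O) :
    UnramifiedWitnessLUAbove k O :=
  decWitness_le_unramifiedWitness (decWitnessLUAbove_of_relLU h)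

/-- The residue-free witness cell is EXACTLY relative local uniformization below (kernel). [folklore] -/
theorem unramifiedWitnessLUAbove_iff_relLU {O : ValuationSubring K} :
    UnramifiedWitnessLUAbove k O ↔ RelLocalUniformization k K O :=
  ⟨relLU_of_unramifiedWitnessLUAbove, unramifiedWitnessLUAbove_of_relLU⟩

/-- On the negative side the three witness/structure cells now coincide with `¬ RelLU`: off the residue-free
cell nothing of the unramified axis is left (row 207: the axis is CLOSED). [folklore] -/
theorem not_unramifiedWitnessLUAbove_iff_not_relLU {O : ValuationSubring K} :
    ¬ UnramifiedWitnessLUAbove k O ↔ ¬ RelLocalUniformization k K O :=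
  not_congr unramifiedWitnessLUAbove_iff_relLU

end Cut6

end Summit.ResolutionOfSingularities.ResolutionOfSingularities.Theorems.InertDescentLU

end
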